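import Mathlib

/-!
# The trivial-tilt regime of the leaf monodromy (lemma FK-T)

Kernel #220 of the solo-blind programme (paper §24.112, audit finding F-s88-1).  The outer
certificate `(P⁺)_F` is two-dimensional: besides the pattern parameter `P = k · Re_p` it depends
on the cross-leaf tilt `κ = k²`, and for `P ≥ P₁` every `κ ∈ (0, κ_t(P)]` occurs along the
subsequence.  The energy identity of the leaf-aligned Kelvin chain gives, for the monodromy
`M(P, κ)` in the plain `ℓ²` norm,
`log ‖M(P, κ)‖ ≤ Σ_T + K₀ P Π_T / (2 √κ) - K₀ κ Γ_T`
(`Σ_T` = integrated strain rate of the carrier along the leaf, `Π_T = ∫ |p|` the integrated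
pattern polarisation entering lift-up with pattern Reynolds number `R = P/√κ`, `Γ_T = ∫ g` the
integrated horizontal-viscosity weight; the Doppler coupling is skew and drops out).  This file
proves the real-number core: the exponent is negative as soon as
`κ ^ (3/2) ≥ P Π_T / Γ_T` and `κ > 2 Σ_T / (K₀ Γ_T)`, the conversion of the first condition to
`κ ≥ (P Π_T / Γ_T) ^ (2/3)`, and the resulting contraction / resolvent bound.  Everything at
smaller tilt, `κ_Lip(P) < κ < κ_t(P) ≍ P ^ (2/3)`, is the open lemma FK of F-s88-1.
-/

namespace Summit.AnomalousDissipation.AnomalousDissipation.Theorems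

/-- Pointwise energy rate of the chain: strain `s`, lift-up `K₀ R |p|` split by Young's
inequality between the horizontal and vertical energies `Eh + Ew = E`, horizontal viscosity
`K₀ κ g` on everything.  If `2ab ≤ Eh + Ew` bounds the shifted Cauchy–Schwarz pairing `ab` of
horizontal against vertical amplitudes, the rate is at most `(2s + K₀ R |p| - 2 K₀ κ g) E`. -/
theorem fkT_energy_rate (s K₀ R p κ g Eh Ew ab : ℝ) (hK : 0 ≤ K₀) (hR : 0 ≤ R) (hp : 0 ≤ p)
    (hs : 0 ≤ s) (hEw : 0 ≤ Ew) (hab : 2 * ab ≤ Eh + Ew) :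
    2 * s * Eh + K₀ * R * p * (2 * ab) - 2 * K₀ * κ * g * (Eh + Ew)
      ≤ (2 * s + K₀ * R * p - 2 * K₀ * κ * g) * (Eh + Ew) := by
  have h1 : K₀ * R * p * (2 * ab) ≤ K₀ * R * p * (Eh + Ew) :=
    mul_le_mul_of_nonneg_left hab (by positivity)
  have h2 : 2 * s * Eh ≤ 2 * s * (Eh + Ew) := by nlinarith
  nlinarith

/-- The FK-T threshold: if `κ · √κ ≥ P Q / G` and `2 S < K₀ G κ` then the Grönwall exponent
`S + K₀ P Q / (2 √κ) - K₀ κ G` of the monodromy is negative. -/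
theorem fkT_exponent_neg (K₀ P Q G S κ : ℝ) (hK : 0 < K₀)
    (hG : 0 < G) (hκ : 0 < κ) (h1 : P * Q / G ≤ κ * Real.sqrt κ) (h2 : 2 * S < K₀ * G * κ) :
    S + K₀ * P * Q / (2 * Real.sqrt κ) - K₀ * κ * G < 0 := by
  have hsq : 0 < Real.sqrt κ := Real.sqrt_pos.mpr hκ
  have h1' : P * Q ≤ G * κ * Real.sqrt κ := by
    have := (div_le_iff₀ hG).mp h1
    nlinarith
  -- lift-up term ≤ K₀ G κ / 2
  have hA : K₀ * P * Q / (2 * Real.sqrt κ) ≤ K₀ * G * κ / 2 := by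
    rw [div_le_iff₀ (by positivity)]
    have : K₀ * (P * Q) ≤ K₀ * (G * κ * Real.sqrt κ) := mul_le_mul_of_nonneg_left h1' hK.le
    nlinarith
  nlinarith

/-- Conversion of the power condition: for `a ≥ 0`, `a ^ (2/3) ≤ κ` implies `a ≤ κ · √κ`. -/
theorem fkT_rpow_condition (a κ : ℝ) (ha : 0 ≤ a) (h : a ^ ((2 : ℝ) / 3) ≤ κ) :
    a ≤ κ * Real.sqrt κ := by
  have hκ : 0 ≤ κ := le_trans (Real.rpow_nonneg ha _) h
  have hmono : (a ^ ((2 : ℝ) / 3)) ^ ((3 : ℝ) / 2) ≤ κ ^ ((3 : ℝ) / 2) :=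
    Real.rpow_le_rpow (Real.rpow_nonneg ha _) h (by norm_num)
  have hleft : (a ^ ((2 : ℝ) / 3)) ^ ((3 : ℝ) / 2) = a := by
    rw [← Real.rpow_mul ha]; norm_num
  have hright : κ ^ ((3 : ℝ) / 2) = κ * Real.sqrt κ := by
    rcases eq_or_lt_of_le hκ with h0 | hpos
    · rw [← h0, Real.zero_rpow (by norm_num), zero_mul]
    · rw [show ((3 : ℝ) / 2) = 1 + (1 / 2 : ℝ) by norm_num, Real.rpow_add hpos, Real.rpow_one,
        Real.sqrt_eq_rpow]
  rw [hleft, hright] at hmono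
  exact hmono

/-- FK-T assembled: with `κ_t(P) := max ((P Q/G)^(2/3)) (2 S/(K₀ G))`, every tilt `κ > κ_t(P)`
(and `κ ≥ (P Q/G)^(2/3)`) has a negative Grönwall exponent, hence `‖M(P,κ)‖ ≤ exp(exponent) < 1`
for any quantity `nM` dominated by that exponential, and the Neumann bound `1/(1 - nM)` is finite. -/
theorem fkT_contraction (K₀ P Q G S κ nM : ℝ) (hK : 0 < K₀) (hP : 0 ≤ P) (hQ : 0 ≤ Q)
    (hG : 0 < G) (hκ : 0 < κ) (hpow : (P * Q / G) ^ ((2 : ℝ) / 3) ≤ κ)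
    (hlin : 2 * S / (K₀ * G) < κ)
    (hM : nM ≤ Real.exp (S + K₀ * P * Q / (2 * Real.sqrt κ) - K₀ * κ * G)) :
    nM < 1 ∧ 0 < 1 - nM := by
  have h1 : P * Q / G ≤ κ * Real.sqrt κ :=
    fkT_rpow_condition _ _ (div_nonneg (mul_nonneg hP hQ) hG.le) hpow
  have h2 : 2 * S < K₀ * G * κ := by
    have := (div_lt_iff₀ (mul_pos hK hG)).mp hlin
    linarith [this]
  have hneg := fkT_exponent_neg K₀ P Q G S κ hK hG hκ h1 h2
  have hexp : Real.exp (S + K₀ * P * Q / (2 * Real.sqrt κ) - K₀ * κ * G) < 1 :=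
    Real.exp_lt_one_iff.mpr hneg  -- `exp x < 1 ↔ x < 0`
  constructor <;> linarith

/-- Scaling of the threshold: `κ_t` grows like `P^(2/3)` — doubling... precisely, the power part
is monotone in `P`, so a tilt that is trivial at `P` is trivial at every smaller `P' ≤ P`
(the trivial region `{κ ≥ κ_t(P)}` shrinks as `P` grows; FK proper is the complement). -/
theorem fkT_threshold_mono (P P' Q G : ℝ) (hP : 0 ≤ P') (hPP : P' ≤ P) (hQ : 0 ≤ Q)
    (hG : 0 < G) :
    (P' * Q / G) ^ ((2 : ℝ) / 3) ≤ (P * Q / G) ^ ((2 : ℝ) / 3) := by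
  apply Real.rpow_le_rpow (div_nonneg (mul_nonneg hP hQ) hG.le) _ (by norm_num)
  exact div_le_div_of_nonneg_right (mul_le_mul_of_nonneg_right hPP hQ) hG.le

end Summit.AnomalousDissipation.AnomalousDissipation.Theorems
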